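import Literature.MathematicalPhysics.QuantumLattice.Imbrie2016.LLA

/-!
# Imbrie (2016), Assumption LLA: every disorder direction of the classical landscape of (1.1) has rank ≥ 2^(n-2)
# (a real-coefficient Reed–Muller bound), for ALL block sizes n

CITATION HEADER (lean-in-tree rule 2026-08-18). J. Z. Imbrie, *On many-body localization for quantum spin chains*,
J. Stat. Phys. **163** (2016) 998–1048, doi 10.1007/s10955-016-1508-x, arXiv:1403.7837 [ImbrieJSP2016], eq. (1.1): the diagonal
part of the box Hamiltonian is `diagEnergy p σ = Σ_i h_i σ_i + Σ_b J_b σ_{b-1} σ_b` (`LLA.lean`, `+` boundary condition), a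
multilinear polynomial of degree `≤ 2` in the spins `σ_i = ±1`.  The counting lemma is the real-coefficient analogue of the
minimum distance of Reed–Muller codes, F. J. MacWilliams, N. J. A. Sloane, *The Theory of Error-Correcting Codes* (1977),
Ch. 13 §3 Thm. 3 ("`𝓡(r, m)` has minimum distance `2^(m-r)`", proved "by induction on `m`" through the `|u|u+v|` construction,
Thm. 2) [MacWilliamsSloane1977]; here the same induction is carried out for REAL-valued functions on `{±1}^n`
(split off the first spin: `f(±, σ') = e(σ') ± o(σ')` with `deg e ≤ d`, `deg o ≤ d - 1`).

WHAT IS PROVED (audit cell `pub-imbrie`, LLA.md block O4(a) — previously kernel-checked only at `n = 3`,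
`BlockMinamiSteps.threeSpin_landscape_support`; NOT a statement of the paper).
* `DegLT n d f` — "the multilinear (Walsh) degree of `f : (Fin n → Bool) → ℝ` is `< d`", defined by recursion on `n`
  (`DegLT 0 d f := (d = 0 → f = 0)`, `DegLT (n+1) d f := DegLT n d (evPart f) ∧ DegLT n (d-1) (odPart f)`); it is closed under
  sums, scalars and products (`DegLT.add/.smul/.sum/.mul`, degrees add), `DegLT n 0 f ↔ f = 0`, constants have degree `< 1`,
  spins `σ_i` degree `< 2`.
* `two_pow_le_two_pow_mul_card_support` (REAL REED–MULLER BOUND): if `DegLT n (d+1) f` and `f ≠ 0` then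
  `2^n ≤ 2^d · #{σ | f σ ≠ 0}`, i.e. a non-zero multilinear polynomial of degree `≤ d` on `{±1}^n` has `≥ 2^(n-d)` non-zeros.
* `degLT_landscape`: every element `σ ↦ c₀ + diagEnergy q σ` of the landscape span `𝓛_n = span{1, σ_i, σ_i σ_{i+1}}` has
  degree `≤ 2`; hence (`two_pow_le_four_mul_card_support_landscape`, `two_pow_le_four_mul_rank_diagonal_landscape`) every
  NON-ZERO landscape direction `f` has `#supp f ≥ 2^(n-2)`, i.e. the diagonal matrix `diag(f) = ∂H/∂(coupling direction)` has
  rank `≥ 2^(n-2)` — for every `n`, every direction `q` of the couplings `(h, J)` and every energy shift `c₀`.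
* `reedMuller_bound_two_attained`: the bound is SHARP in degree `2` — the bond-cell indicator `𝟙{σ₀ = σ₁ = +} = ¼(1+σ₀)(1+σ₁)`
  (`cellIndicator`, an element of `𝓛_n`) has exactly `2^(n-2)` non-zeros (`card_support_cellIndicator`).
MEANING (LLA.md O4(a)): in ANY linear coordinates on the diagonal disorder of (1.1), one-variable eigenvalue interlacing moves the
eigenvalue counting function by up to `2^(n-2)`, so the Minami/CGK/HK mechanism controls clusters of `2^(n-2)+1` levels and no
fewer; it yields LLA (pairs) exactly for `n ≤ 2`.  This is an OBSTRUCTION statement about one technique; it neither proves nor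
disproves LLA, which remains an OPEN, UNPROVED hypothesis of [ImbrieJSP2016, Thm 1.1].  No `sorry`, no new axioms.
-/

namespace Literature.MathematicalPhysics.QuantumLattice.Imbrie2016

open Finset

section ReedMuller

variable {n : ℕ}

/-- [cite: MacWilliamsSloane1977, Ch. 13 §3 Thm. 2] restriction of `f : {±1}^(n+1) → ℝ` to first spin up (`u + v`). -/
def hiPart (f : (Fin (n + 1) → Bool) → ℝ) : (Fin n → Bool) → ℝ := fun σ => f (Fin.cons true σ)

/-- [cite: MacWilliamsSloane1977, Ch. 13 §3 Thm. 2] restriction of `f : {±1}^(n+1) → ℝ` to first spin down (`u`). -/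
def loPart (f : (Fin (n + 1) → Bool) → ℝ) : (Fin n → Bool) → ℝ := fun σ => f (Fin.cons false σ)

/-- [cite: MacWilliamsSloane1977, Ch. 13 §3 Thm. 2] even part in the first spin: `f = evPart + σ₀ · odPart`. -/
noncomputable def evPart (f : (Fin (n + 1) → Bool) → ℝ) : (Fin n → Bool) → ℝ :=
  fun σ => (hiPart f σ + loPart f σ) / 2

/-- [cite: MacWilliamsSloane1977, Ch. 13 §3 Thm. 2] odd part in the first spin: `f = evPart + σ₀ · odPart`. -/
noncomputable def odPart (f : (Fin (n + 1) → Bool) → ℝ) : (Fin n → Bool) → ℝ :=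
  fun σ => (hiPart f σ - loPart f σ) / 2

/-- `u + v`: the upper half is `e + o`. [folklore] -/
theorem hiPart_eq (f : (Fin (n + 1) → Bool) → ℝ) : hiPart f = evPart f + odPart f := by
  funext σ; simp only [evPart, odPart, Pi.add_apply]; ring

/-- `u`: the lower half is `e - o`. [folklore] -/
theorem loPart_eq (f : (Fin (n + 1) → Bool) → ℝ) : loPart f = evPart f - odPart f := by
  funext σ; simp only [evPart, odPart, Pi.sub_apply]; ring

/-- [cite: MacWilliamsSloane1977, Ch. 13 §3 Thm. 2] a function vanishing on both halves vanishes. -/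
theorem eq_zero_of_hiPart_loPart {f : (Fin (n + 1) → Bool) → ℝ} (h1 : hiPart f = 0) (h0 : loPart f = 0) : f = 0 := by
  funext σ
  obtain hb | hb := Bool.eq_false_or_eq_true (σ 0)
  · have h := congrFun h1 (Fin.tail σ)
    simp only [hiPart, Pi.zero_apply] at h
    rw [← hb, Fin.cons_self_tail] at h
    simpa using h
  · have h := congrFun h0 (Fin.tail σ)
    simp only [loPart, Pi.zero_apply] at h
    rw [← hb, Fin.cons_self_tail] at h
    simpa using h

/-- the even part is additive. [folklore] -/
theorem evPart_add (f g : (Fin (n + 1) → Bool) → ℝ) : evPart (f + g) = evPart f + evPart g := by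
  funext σ; simp only [evPart, hiPart, loPart, Pi.add_apply]; ring

/-- the odd part is additive. [folklore] -/
theorem odPart_add (f g : (Fin (n + 1) → Bool) → ℝ) : odPart (f + g) = odPart f + odPart g := by
  funext σ; simp only [odPart, hiPart, loPart, Pi.add_apply]; ring

/-- the even part commutes with scalars. [folklore] -/
theorem evPart_smul (c : ℝ) (f : (Fin (n + 1) → Bool) → ℝ) : evPart (c • f) = c • evPart f := by
  funext σ; simp only [evPart, hiPart, loPart, Pi.smul_apply, smul_eq_mul]; ring

/-- the odd part commutes with scalars. [folklore] -/
theorem odPart_smul (c : ℝ) (f : (Fin (n + 1) → Bool) → ℝ) : odPart (c • f) = c • odPart f := by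
  funext σ; simp only [odPart, hiPart, loPart, Pi.smul_apply, smul_eq_mul]; ring

/-- even part of a product: `e_f e_g + o_f o_g` (uses `σ₀² = 1`). [folklore] -/
theorem evPart_mul (f g : (Fin (n + 1) → Bool) → ℝ) :
    evPart (f * g) = evPart f * evPart g + odPart f * odPart g := by
  funext σ; simp only [evPart, odPart, hiPart, loPart, Pi.mul_apply, Pi.add_apply]; ring

/-- odd part of a product: `e_f o_g + o_f e_g`. [folklore] -/
theorem odPart_mul (f g : (Fin (n + 1) → Bool) → ℝ) :
    odPart (f * g) = evPart f * odPart g + odPart f * evPart g := by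
  funext σ; simp only [evPart, odPart, hiPart, loPart, Pi.mul_apply, Pi.add_apply]; ring

/-- the even part of `0` is `0`. [folklore] -/
theorem evPart_zero : evPart (0 : (Fin (n + 1) → Bool) → ℝ) = 0 := by
  funext σ; simp [evPart, hiPart, loPart]

/-- the odd part of `0` is `0`. [folklore] -/
theorem odPart_zero : odPart (0 : (Fin (n + 1) → Bool) → ℝ) = 0 := by
  funext σ; simp [odPart, hiPart, loPart]

end ReedMuller

/-- [cite: MacWilliamsSloane1977, Ch. 13 §3 Thm. 3] `DegLT n d f`: the multilinear (Walsh) degree of `f : {±1}^n → ℝ` is `< d`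
(so `DegLT n 0 f ↔ f = 0`, and "degree ≤ d" is `DegLT n (d+1)`), by recursion on the number of spins:
`f = e + σ₀ · o` has degree `< d` iff `deg e < d` and `deg o < d - 1`. -/
def DegLT : (n : ℕ) → ℕ → ((Fin n → Bool) → ℝ) → Prop
  | 0, d, f => d = 0 → f = 0
  | n + 1, d, f => DegLT n d (evPart f) ∧ DegLT n (d - 1) (odPart f)

section DegLT

/-- unfolding `DegLT` on zero spins. [folklore] -/
theorem degLT_zero_left (d : ℕ) (f : (Fin 0 → Bool) → ℝ) : DegLT 0 d f ↔ (d = 0 → f = 0) := Iff.rfl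

/-- unfolding `DegLT` on `n + 1` spins. [folklore] -/
theorem degLT_succ_left {n : ℕ} (d : ℕ) (f : (Fin (n + 1) → Bool) → ℝ) :
    DegLT (n + 1) d f ↔ DegLT n d (evPart f) ∧ DegLT n (d - 1) (odPart f) := Iff.rfl

/-- [cite: MacWilliamsSloane1977, Ch. 13 §3 Thm. 3] the zero function has every degree bound. -/
theorem degLT_zero_fun : ∀ {n : ℕ} (d : ℕ), DegLT n d (0 : (Fin n → Bool) → ℝ)
  | 0, d => by rw [degLT_zero_left]; intro; rfl
  | n + 1, d => by
      rw [degLT_succ_left, evPart_zero, odPart_zero]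
      exact ⟨degLT_zero_fun d, degLT_zero_fun (d - 1)⟩

/-- [cite: MacWilliamsSloane1977, Ch. 13 §3 Thm. 3] degree `< 0` means identically zero. -/
theorem degLT_zero_iff : ∀ {n : ℕ} (f : (Fin n → Bool) → ℝ), DegLT n 0 f ↔ f = 0
  | 0, f => by rw [degLT_zero_left]; simp
  | n + 1, f => by
      rw [degLT_succ_left, Nat.zero_sub, degLT_zero_iff (evPart f), degLT_zero_iff (odPart f)]
      constructor
      · rintro ⟨he, ho⟩
        apply eq_zero_of_hiPart_loPart
        · rw [hiPart_eq, he, ho, add_zero]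
        · rw [loPart_eq, he, ho, sub_zero]
      · rintro rfl
        exact ⟨evPart_zero, odPart_zero⟩

/-- [cite: MacWilliamsSloane1977, Ch. 13 §3 Thm. 3] monotonicity of the degree bound. -/
theorem DegLT.mono : ∀ {n d d' : ℕ} {f : (Fin n → Bool) → ℝ}, d ≤ d' → DegLT n d f → DegLT n d' f
  | 0, d, d', f, h, hf => by
      rw [degLT_zero_left] at hf ⊢
      intro hd'
      exact hf (by omega)
  | n + 1, d, d', f, h, hf => by
      rw [degLT_succ_left] at hf ⊢
      exact ⟨hf.1.mono h, hf.2.mono (by omega)⟩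

/-- [cite: MacWilliamsSloane1977, Ch. 13 §3 Thm. 3] sums keep the degree bound (the code is linear). -/
theorem DegLT.add : ∀ {n d : ℕ} {f g : (Fin n → Bool) → ℝ}, DegLT n d f → DegLT n d g → DegLT n d (f + g)
  | 0, d, f, g, hf, hg => by
      rw [degLT_zero_left] at hf hg ⊢
      intro hd
      rw [hf hd, hg hd, add_zero]
  | n + 1, d, f, g, hf, hg => by
      rw [degLT_succ_left] at hf hg ⊢
      rw [evPart_add, odPart_add]
      exact ⟨hf.1.add hg.1, hf.2.add hg.2⟩

/-- [cite: MacWilliamsSloane1977, Ch. 13 §3 Thm. 3] scalar multiples keep the degree bound. -/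
theorem DegLT.smul (c : ℝ) : ∀ {n d : ℕ} {f : (Fin n → Bool) → ℝ}, DegLT n d f → DegLT n d (c • f)
  | 0, d, f, hf => by
      rw [degLT_zero_left] at hf ⊢
      intro hd
      rw [hf hd, smul_zero]
  | n + 1, d, f, hf => by
      rw [degLT_succ_left] at hf ⊢
      rw [evPart_smul, odPart_smul]
      exact ⟨hf.1.smul c, hf.2.smul c⟩

/-- [cite: MacWilliamsSloane1977, Ch. 13 §3 Thm. 3] finite sums keep the degree bound. -/
theorem DegLT.sum {n d : ℕ} {ι : Type*} (s : Finset ι) {F : ι → (Fin n → Bool) → ℝ}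
    (h : ∀ i ∈ s, DegLT n d (F i)) : DegLT n d (∑ i ∈ s, F i) :=
  Finset.sum_induction F (DegLT n d) (fun _ _ ha hb => ha.add hb) (degLT_zero_fun d) h

/-- [cite: MacWilliamsSloane1977, Ch. 13 §3 Thm. 3] degrees add under products: `deg f < a`, `deg g < b` ⟹
`deg (f g) < a + b - 1` (multilinear reduction `σ_i² = 1` is built into the encoding). -/
theorem DegLT.mul : ∀ {n a b : ℕ} {f g : (Fin n → Bool) → ℝ}, DegLT n a f → DegLT n b g → DegLT n (a + b - 1) (f * g)
  | 0, a, b, f, g, hf, hg => by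
      rw [degLT_zero_left] at hf hg ⊢
      intro hab
      rcases Nat.eq_zero_or_pos a with ha | ha
      · rw [hf ha, zero_mul]
      · rw [hg (by omega), mul_zero]
  | n + 1, a, b, f, g, hf, hg => by
      rcases Nat.eq_zero_or_pos a with ha | ha
      · subst ha
        rw [(degLT_zero_iff f).1 hf, zero_mul]
        exact degLT_zero_fun _
      rcases Nat.eq_zero_or_pos b with hb | hb
      · subst hb
        rw [(degLT_zero_iff g).1 hg, mul_zero]
        exact degLT_zero_fun _
      rw [degLT_succ_left] at hf hg ⊢
      rw [evPart_mul, odPart_mul]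
      refine ⟨(hf.1.mul hg.1).add ((hf.2.mul hg.2).mono (by omega)), ?_⟩
      exact ((hf.1.mul hg.2).mono (by omega)).add ((hf.2.mul hg.1).mono (by omega))

/-- [cite: MacWilliamsSloane1977, Ch. 13 §3 Thm. 3] constants have degree `< 1`. -/
theorem degLT_const : ∀ {n : ℕ} (c : ℝ), DegLT n 1 (fun _ : Fin n → Bool => c)
  | 0, c => by rw [degLT_zero_left]; intro h; exact absurd h one_ne_zero
  | n + 1, c => by
      have he : evPart (fun _ : Fin (n + 1) → Bool => c) = fun _ => c := by
        funext σ; simp only [evPart, hiPart, loPart]; ring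
      have ho : odPart (fun _ : Fin (n + 1) → Bool => c) = 0 := by
        funext σ; simp [odPart, hiPart, loPart]
      rw [degLT_succ_left, he, ho]
      exact ⟨degLT_const c, degLT_zero_fun _⟩

/-- [cite: ImbrieJSP2016, eq. (1.1)] the spin variable `σ_i = ±1` as a real function of the configuration. -/
def spin {n : ℕ} (i : Fin n) : (Fin n → Bool) → ℝ := fun σ => if σ i then 1 else -1

/-- [cite: MacWilliamsSloane1977, Ch. 13 §3 Thm. 3] a single spin has degree `< 2`. -/
theorem degLT_spin : ∀ {n : ℕ} (i : Fin n), DegLT n 2 (spin i)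
  | 0, i => i.elim0
  | n + 1, i => by
      refine Fin.cases ?_ (fun j => ?_) i
      · have he : evPart (spin (0 : Fin (n + 1))) = 0 := by
          funext σ; simp [evPart, hiPart, loPart, spin]
        have ho : odPart (spin (0 : Fin (n + 1))) = fun _ => 1 := by
          funext σ; simp only [odPart, hiPart, loPart, spin, Fin.cons_zero]; norm_num
        rw [degLT_succ_left, he, ho]
        exact ⟨degLT_zero_fun _, degLT_const 1⟩
      · have he : evPart (spin j.succ) = spin j := by
          funext σ; simp only [evPart, hiPart, loPart, spin, Fin.cons_succ]; ring
        have ho : odPart (spin j.succ) = 0 := by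
          funext σ; simp [odPart, hiPart, loPart, spin, Fin.cons_succ]
        rw [degLT_succ_left, he, ho]
        exact ⟨degLT_spin j, degLT_zero_fun _⟩

/-- [cite: MacWilliamsSloane1977, Ch. 13 §3 Thm. 2] the support splits over the two values of the first spin
(`wt |u|u+v| = wt u + wt (u+v)`). -/
theorem card_support_succ {n : ℕ} (f : (Fin (n + 1) → Bool) → ℝ) :
    (univ.filter fun σ => f σ ≠ 0).card =
      (univ.filter fun σ => hiPart f σ ≠ 0).card + (univ.filter fun σ => loPart f σ ≠ 0).card := by
  classical
  simp only [Finset.card_filter]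
  rw [← (Fin.consEquiv (fun _ : Fin (n + 1) => Bool)).sum_comp (fun σ => if f σ ≠ 0 then 1 else 0)]
  rw [Fintype.sum_prod_type, Fintype.sum_bool]
  rfl

/-- [cite: MacWilliamsSloane1977, Ch. 13 §3 Thm. 3] **REAL REED–MULLER BOUND.** A non-zero real multilinear polynomial of
degree `≤ d` on `{±1}^n` has at least `2^(n-d)` non-zeros: `DegLT n (d+1) f`, `f ≠ 0` ⟹ `2^n ≤ 2^d · #{σ | f σ ≠ 0}`.
Induction on `n` (the `|u|u+v|` step): `f(±, σ') = e ± o`; if `o = 0` both halves are `e ≠ 0`; if one half vanishes the other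
is `±2o` with `deg o ≤ d - 1`; otherwise both halves are non-zero of degree `≤ d`. -/
theorem two_pow_le_two_pow_mul_card_support :
    ∀ {n : ℕ} (d : ℕ) (f : (Fin n → Bool) → ℝ), DegLT n (d + 1) f → f ≠ 0 →
      2 ^ n ≤ 2 ^ d * (univ.filter fun σ => f σ ≠ 0).card
  | 0, d, f, _, hne => by
      have h0 : f default ≠ 0 := by
        intro h
        apply hne
        funext σ
        rw [Subsingleton.elim σ default, h, Pi.zero_apply]
      have hmem : default ∈ (univ.filter fun σ : Fin 0 → Bool => f σ ≠ 0) :=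
        Finset.mem_filter.2 ⟨Finset.mem_univ _, h0⟩
      have hcard : 1 ≤ (univ.filter fun σ : Fin 0 → Bool => f σ ≠ 0).card := Finset.card_pos.2 ⟨_, hmem⟩
      calc 2 ^ 0 = 1 * 1 := by norm_num
        _ ≤ 2 ^ d * (univ.filter fun σ : Fin 0 → Bool => f σ ≠ 0).card :=
          Nat.mul_le_mul Nat.one_le_two_pow hcard
  | n + 1, d, f, hf, hne => by
      rw [degLT_succ_left, Nat.add_sub_cancel] at hf
      obtain ⟨hev, hod⟩ := hf
      rw [card_support_succ]
      by_cases hz : odPart f = 0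
      · have hhi : hiPart f = evPart f := by rw [hiPart_eq, hz, add_zero]
        have hlo : loPart f = evPart f := by rw [loPart_eq, hz, sub_zero]
        have hne' : evPart f ≠ 0 := fun h => hne (eq_zero_of_hiPart_loPart (hhi.trans h) (hlo.trans h))
        have ih := two_pow_le_two_pow_mul_card_support d (evPart f) hev hne'
        rw [hhi, hlo]
        calc 2 ^ (n + 1) = 2 ^ n + 2 ^ n := by ring
          _ ≤ 2 ^ d * (univ.filter fun σ => evPart f σ ≠ 0).card
                + 2 ^ d * (univ.filter fun σ => evPart f σ ≠ 0).card := add_le_add ih ih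
          _ = _ := by ring
      · obtain ⟨d', rfl⟩ : ∃ d', d = d' + 1 := by
          rcases Nat.eq_zero_or_pos d with h | h
          · subst h
            exact absurd ((degLT_zero_iff _).1 hod) hz
          · exact ⟨d - 1, by omega⟩
        have ihod := two_pow_le_two_pow_mul_card_support d' (odPart f) hod hz
        by_cases h1 : hiPart f = 0
        · -- upper half vanishes: `e = -o`, lower half `= -2 o`
          have hlo : ∀ σ, loPart f σ = -2 * odPart f σ := by
            intro σ
            have ha := congrFun (hiPart_eq f) σ
            have hb := congrFun (loPart_eq f) σ
            rw [h1] at ha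
            simp only [Pi.zero_apply, Pi.add_apply, Pi.sub_apply] at ha hb
            linarith
          have hsupp : (univ.filter fun σ => loPart f σ ≠ 0) = (univ.filter fun σ => odPart f σ ≠ 0) := by
            refine Finset.filter_congr fun σ _ => ?_
            rw [hlo σ]
            simp
          rw [hsupp]
          calc 2 ^ (n + 1) = 2 * 2 ^ n := by ring
            _ ≤ 2 * (2 ^ d' * (univ.filter fun σ => odPart f σ ≠ 0).card) := Nat.mul_le_mul_left 2 ihod
            _ = 2 ^ (d' + 1) * (univ.filter fun σ => odPart f σ ≠ 0).card := by ring
            _ ≤ 2 ^ (d' + 1) * ((univ.filter fun σ => hiPart f σ ≠ 0).card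
                  + (univ.filter fun σ => odPart f σ ≠ 0).card) :=
                Nat.mul_le_mul_left _ (Nat.le_add_left _ _)
        by_cases h0 : loPart f = 0
        · -- lower half vanishes: `e = o`, upper half `= 2 o`
          have hhi : ∀ σ, hiPart f σ = 2 * odPart f σ := by
            intro σ
            have ha := congrFun (hiPart_eq f) σ
            have hb := congrFun (loPart_eq f) σ
            rw [h0] at hb
            simp only [Pi.zero_apply, Pi.add_apply, Pi.sub_apply] at ha hb
            linarith
          have hsupp : (univ.filter fun σ => hiPart f σ ≠ 0) = (univ.filter fun σ => odPart f σ ≠ 0) := by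
            refine Finset.filter_congr fun σ _ => ?_
            rw [hhi σ]
            simp
          rw [hsupp]
          calc 2 ^ (n + 1) = 2 * 2 ^ n := by ring
            _ ≤ 2 * (2 ^ d' * (univ.filter fun σ => odPart f σ ≠ 0).card) := Nat.mul_le_mul_left 2 ihod
            _ = 2 ^ (d' + 1) * (univ.filter fun σ => odPart f σ ≠ 0).card := by ring
            _ ≤ 2 ^ (d' + 1) * ((univ.filter fun σ => odPart f σ ≠ 0).card
                  + (univ.filter fun σ => loPart f σ ≠ 0).card) :=
                Nat.mul_le_mul_left _ (Nat.le_add_right _ _)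
        -- both halves non-zero, each of degree ≤ d
        have hdeg1 : DegLT n (d' + 1 + 1) (hiPart f) := by
          rw [hiPart_eq]
          exact hev.add (hod.mono (by omega))
        have hdeg0 : DegLT n (d' + 1 + 1) (loPart f) := by
          rw [loPart_eq, sub_eq_add_neg, ← neg_one_smul ℝ (odPart f)]
          exact hev.add ((hod.smul (-1)).mono (by omega))
        have ih1 := two_pow_le_two_pow_mul_card_support (d' + 1) (hiPart f) hdeg1 h1
        have ih0 := two_pow_le_two_pow_mul_card_support (d' + 1) (loPart f) hdeg0 h0
        calc 2 ^ (n + 1) = 2 ^ n + 2 ^ n := by ring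
          _ ≤ 2 ^ (d' + 1) * (univ.filter fun σ => hiPart f σ ≠ 0).card
                + 2 ^ (d' + 1) * (univ.filter fun σ => loPart f σ ≠ 0).card := add_le_add ih1 ih0
          _ = _ := by ring

end DegLT


/-! ### Sharpness: the bound `2^(n-2)` for degree ≤ 2 is attained by a bond-cell indicator -/

section Sharpness

/-- [cite: ImbrieJSP2016, eq. (1.1)] the bond-cell indicator `𝟙{σ₀ = σ₁ = +} = (1 + σ₀)(1 + σ₁)/4` on `m + 2` spins — the
element `¼ + ¼σ₀ + ¼σ₁ + ¼σ₀σ₁` of the landscape span `𝓛_(m+2)` (bond `b = 1` of (1.1) couples sites `0` and `1`;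
LLA.md O4(a): "attained by the bond-cell indicators"). -/
noncomputable def cellIndicator (m : ℕ) : (Fin (m + 2) → Bool) → ℝ :=
  fun σ => if σ 0 = true ∧ σ 1 = true then 1 else 0

/-- [cite: ImbrieJSP2016, eq. (1.1)] `𝟙{σ₀ = σ₁ = +} = ¼ (1 + σ₀)(1 + σ₁)`. -/
theorem cellIndicator_eq (m : ℕ) :
    cellIndicator m = (1 / 4 : ℝ) • (((fun _ => (1 : ℝ)) + spin 0) * ((fun _ => (1 : ℝ)) + spin 1)) := by
  funext σ
  simp only [cellIndicator, spin, Pi.smul_apply, Pi.mul_apply, Pi.add_apply, smul_eq_mul]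
  cases σ 0 <;> cases σ 1 <;> norm_num

/-- [cite: MacWilliamsSloane1977, Ch. 13 §3 Thm. 3] the bond-cell indicator has degree `≤ 2`. -/
theorem degLT_cellIndicator (m : ℕ) : DegLT (m + 2) 3 (cellIndicator m) := by
  rw [cellIndicator_eq]
  exact ((((degLT_const 1).mono (by norm_num)).add (degLT_spin 0)).mul
    (((degLT_const 1).mono (by norm_num)).add (degLT_spin 1))).smul _

/-- [cite: ImbrieJSP2016, eq. (1.1)] the bond-cell indicator is not the zero direction. -/
theorem cellIndicator_ne_zero (m : ℕ) : cellIndicator m ≠ 0 := by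
  intro h
  have h1 := congrFun h (fun _ => true)
  simp [cellIndicator] at h1

/-- [cite: MacWilliamsSloane1977, Ch. 13 §3 Thm. 3] its support is one cell: exactly `2^m = 2^((m+2)-2)` configurations
(two applications of the `|u|u+v|` splitting `card_support_succ`). -/
theorem card_support_cellIndicator (m : ℕ) :
    (univ.filter fun σ => cellIndicator m σ ≠ 0).card = 2 ^ m := by
  rw [card_support_succ]
  have hlo : loPart (cellIndicator m) = 0 := by
    funext σ; simp [loPart, cellIndicator]
  have hhi : hiPart (cellIndicator m) = fun σ : Fin (m + 1) → Bool => if σ 0 = true then (1 : ℝ) else 0 := by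
    funext σ; simp [hiPart, cellIndicator, Fin.cons_one]
  rw [hlo, hhi, card_support_succ]
  have hlo' : loPart (fun σ : Fin (m + 1) → Bool => if σ 0 = true then (1 : ℝ) else 0) = 0 := by
    funext σ; simp [loPart]
  have hhi' : hiPart (fun σ : Fin (m + 1) → Bool => if σ 0 = true then (1 : ℝ) else 0) = fun _ => 1 := by
    funext σ; simp [hiPart]
  rw [hlo', hhi']
  simp

/-- [cite: MacWilliamsSloane1977, Ch. 13 §3 Thm. 3] **the real Reed–Muller bound is sharp in degree 2** (and so is O4(a)):
on `n = m + 2 ≥ 2` spins there is a non-zero function of degree `≤ 2` — the bond-cell indicator, an element of the landscape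
span — with EXACTLY `2^(n-2)` non-zeros: `4 · #supp = 2^n`.  Hence the interlacing reach `2^(n-2)` of LLA.md O4(a) is exact. -/
theorem reedMuller_bound_two_attained (m : ℕ) :
    ∃ f : (Fin (m + 2) → Bool) → ℝ, DegLT (m + 2) 3 f ∧ f ≠ 0 ∧
      4 * (univ.filter fun σ => f σ ≠ 0).card = 2 ^ (m + 2) :=
  ⟨cellIndicator m, degLT_cellIndicator m, cellIndicator_ne_zero m, by
    rw [card_support_cellIndicator]; ring⟩

end Sharpness

/-! ### The landscape of (1.1): every direction has degree ≤ 2, hence support ≥ 2^(n-2) -/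

section Landscape

variable {n : ℕ}

/-- [cite: ImbrieJSP2016, eq. (1.1)] each `S^z` factor of (1.1) — a spin of the box or the boundary value `+1` — has degree
`< 2`. -/
theorem degLT_szZ (k : ℤ) : DegLT n 2 (fun σ : Cfg n => szZ σ k) := by
  unfold szZ
  by_cases h : 0 ≤ k ∧ k < n
  · simp only [h, dif_pos, and_self]
    exact degLT_spin _
  · simp only [h, dif_neg, not_false_eq_true]
    exact (degLT_const 1).mono (by norm_num)

/-- [cite: ImbrieJSP2016, eq. (1.1)] **the landscape span has degree ≤ 2**: for every parameter set (direction) `q` and energy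
shift `c₀`, `σ ↦ c₀ + diagEnergy q σ = c₀ + Σ h_i σ_i + Σ J_b σ_{b-1} σ_b` has multilinear degree `< 3`. -/
theorem degLT_landscape (q : Params n) (c₀ : ℝ) : DegLT n 3 (fun σ : Cfg n => c₀ + diagEnergy q σ) := by
  have h0 : DegLT n 3 (fun _ : Cfg n => c₀) := (degLT_const c₀).mono (by norm_num)
  have h1 : DegLT n 3 (fun σ : Cfg n => ∑ i : Fin n, q.h i * szZ σ i) := by
    have hfun : (fun σ : Cfg n => ∑ i : Fin n, q.h i * szZ σ i) =
        ∑ i : Fin n, q.h i • (fun σ : Cfg n => szZ σ i) := by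
      funext σ; simp [Finset.sum_apply]
    rw [hfun]
    exact DegLT.sum _ fun i _ => ((degLT_szZ (i : ℤ)).smul _).mono (by norm_num)
  have h2 : DegLT n 3 (fun σ : Cfg n => ∑ b : Fin (n + 1), q.J b * szZ σ ((b : ℤ) - 1) * szZ σ b) := by
    have hfun : (fun σ : Cfg n => ∑ b : Fin (n + 1), q.J b * szZ σ ((b : ℤ) - 1) * szZ σ b) =
        ∑ b : Fin (n + 1), q.J b • ((fun σ : Cfg n => szZ σ ((b : ℤ) - 1)) * (fun σ : Cfg n => szZ σ b)) := by
      funext σ; simp [Finset.sum_apply, mul_assoc]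
    rw [hfun]
    exact DegLT.sum _ fun b _ => ((degLT_szZ _).mul (degLT_szZ _)).smul _
  have hsum : (fun σ : Cfg n => c₀ + diagEnergy q σ) = (fun _ : Cfg n => c₀) +
      ((fun σ : Cfg n => ∑ i : Fin n, q.h i * szZ σ i) +
        (fun σ : Cfg n => ∑ b : Fin (n + 1), q.J b * szZ σ ((b : ℤ) - 1) * szZ σ b)) := by
    funext σ; simp only [diagEnergy, Pi.add_apply]
  rw [hsum]
  exact h0.add (h1.add h2)

/-- [cite: ImbrieJSP2016, eq. (1.1)] **LLA.md O4(a) for all `n`: every non-zero landscape direction has support ≥ 2^(n-2).**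
For every direction `q` of the couplings `(h, J)` (the transverse factors `Γ` do not enter the diagonal part) and every energy
shift `c₀`, if `f = c₀ + diagEnergy q ≠ 0` then `2^n ≤ 4 · #{σ | f σ ≠ 0}`. -/
theorem two_pow_le_four_mul_card_support_landscape (q : Params n) (c₀ : ℝ)
    (hne : (fun σ : Cfg n => c₀ + diagEnergy q σ) ≠ 0) :
    2 ^ n ≤ 4 * (univ.filter fun σ : Cfg n => c₀ + diagEnergy q σ ≠ 0).card := by
  have h := two_pow_le_two_pow_mul_card_support 2 _ (degLT_landscape q c₀) hne
  norm_num at h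
  exact h

/-- [cite: ImbrieJSP2016, eq. (1.1)] the same bound as a RANK statement: the derivative of the box Hamiltonian (1.1) in a
coupling direction `q` (plus an energy shift `c₀`) is the diagonal matrix `diag(c₀ + diagEnergy q)`, and if it is non-zero its
rank is `≥ 2^(n-2)` — one-variable interlacing along ANY disorder coordinate moves eigenvalue counts by up to `2^(n-2)`. -/
theorem two_pow_le_four_mul_rank_diagonal_landscape (q : Params n) (c₀ : ℝ)
    (hne : (fun σ : Cfg n => c₀ + diagEnergy q σ) ≠ 0) :
    2 ^ n ≤ 4 * (Matrix.diagonal fun σ : Cfg n => c₀ + diagEnergy q σ).rank := by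
  classical
  rw [Matrix.rank_diagonal, Fintype.card_subtype]
  exact two_pow_le_four_mul_card_support_landscape q c₀ hne

end Landscape

end Literature.MathematicalPhysics.QuantumLattice.Imbrie2016
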